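/-
Copyright (c) 2026 the pub-hodgecm-mathlib formalisation cell (harness21).  Prover seat hodgecm-mathlib-LH7-p09 (g2), CLOSE-OUT ROSTER strike line L3∕L5 (Track A
«(D-RAM) FOUR-FRAME» squad F0∕P3c∕LH4 ∕ F0∕P3c∕LH7); β₂-BOARD v2 row (OFF) (lead LH7-p09 (g2); β₂ WORD #22: the `hL_mix` assembly by the ω-flip);
helper lane on h413 = stmt-HodgeConjecture-24833 (count-neutral).  2026-09-05.
-/
import Summits.HodgeConjecture.HodgeConjecture.Theorems.F0P3cDyRamLowerLineVertexRay       -- ★ p863761 (this seat): every lower-line vertex is a σ-fixed-unit ray; brings ★ p861154 `…ConeCellFaceAxis`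
import Summits.HodgeConjecture.HodgeConjecture.Theorems.F0P3cDyRamConeWeightHalfSplit       -- ★ (LH4-p11): `dualGen_mul_left` (the dual generator under `x₀ ↦ ε·x₀`)
import HarnessLib

/-!
# Crux `H413`, line LH4 «(D-RAM) FOUR-FRAME» — the (β₂) road (R-36), β₂-BOARD v2 row (OFF), socket `hL_mix` (β₂ WORD #22): «THE ω-FLIP REVERSES THE LABEL ON THE LOWER
# LINE» — for glued vertices `L` over `Λ = x₀·𝒪_cc` and `L′` over `ε·Λ = (εx₀)·𝒪_cc` (`ε·Θε = jE ξ₀`, `ξ₀` a `σ`-fixed NON-norm unit of `E`) on a lower-line cell: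
# `VS_{m*}(L′) = ξ₀⁻¹·VS_{m*}(L)` and `VS(L) = V₊ ↔ VS(L′) ≠ V₊` — the `hface` of ★ `…ConeCellFaceTube.finsum_levelSetDep_inter_weight_eq_of_omegaFace_exchange_of_succ_le`
# GIVEN the two glued vertices (their EXISTENCE over every cell member is the one remaining input of `hL_mix`)

Cell `hodgecm-mathlib` (D-0151), FLOOR 0, crux item H413 = `stmt-HodgeConjecture-24833`, route of record `HCCMUnconditional`; squads F0∕P3c∕LH4 ∕ LH7; lane
`--supports stmt-HodgeConjecture-24833 --as helper` (count-neutral; pays NO tier-0 row).  THEOREMS ONLY (no `def`, no instance, no notation, no `sorry`, default heartbeats);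
★-only imports; states NO law; (β₂) stays a HYPOTHESIS.  Frame = ★ p863761's (★ p16's HEAD frame: sheet datum on `E` with `[CompleteSpace E] [Finite 𝓀[E]]`, block `(H₂, h)`,
★ (C1)'s line model, `jE` isometric), TWO glued vertices, the ω-flip `ε`.

WHY (β₂ WORD #22 (2): «`hL_mix` (b + 1 ≤ d) = ω-flip pairing per LH7-p09 §2 — LH7-p09 keeps that assembly»).  ★ `…ConeCellFaceTube`'s HEAD-lo-ω balances the weighted labelled
counts of a tube cell below the glue conductor GIVEN `hface`: every ω-flip `ε` sends a `+`-vertex over `Λ` to a `−′`-vertex over `ε·Λ` and back.  With ★ p863761 (EVERY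
lower-line vertex is a ray `valueSetMod σ ϖ m* (e′ • X₊)`, `|e₀ − e′t₊| ≤ |ϖ|^{m*}`, `jE e₀ = Tr_ρ(μ∕(cc(α − ρα)·ΘY))`) the face is SCALAR ALGEBRA: ★ `dualGen_mul_left` gives
`Y(εx₀) = jEξ₀·Y(x₀)`, so `ΘY ↦ jEξ₀·ΘY` (`σξ₀ = ξ₀`) and the ray scalar of `L′` is `e₀∕ξ₀`; the two nearly-fixed units then satisfy `|ξ₀⁻¹e′ − e′₁| ≤ |ϖ|^{2d−1}`, whence
`VS(L′) = valueSetMod((ξ₀⁻¹e′) • X₊) = ξ₀⁻¹·VS(L)` (★ p861154 `image_mul_valueSetMod_smul_xPlus`, ★ p862187 `valueSetMod_smul_xPlus_eq_of_v_sub_le_pred`), and ★ p861154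
`image_mul_eq_valueSetMod_plus_iff_not` (index two on the fixed line, with the dichotomy witness `e′`) turns this into `VS(L) = V₊ ↔ ¬ VS(L′) = V₊`.
* §1 `flip_ray_letters` — the scalar lemma: fixed non-norm unit `ξ₀`, rays `S = valueSetMod(e′ • X₊)`, `S′ = valueSetMod(e′₁ • X₊)` with `|e₀ − e′t₊|, |e₀ξ₀⁻¹ − e′₁t₊| ≤ |ϖ|^{m*}`
  ⟹ `S′ = (ξ₀⁻¹·) '' S ∧ (S = valueSetMod X₊ ↔ ¬ S′ = valueSetMod X₊)`.
* §2 HEAD `valueSet_flip_of_line_sizes` — for the two glued vertices on a lower-line cell (★ p863761's letters for `(x₀, L)`, the glue letters of `(εx₀, L′)`, `ε·Θε = jE ξ₀`):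
  `VS_{m*}(L′) = (ξ₀⁻¹·) '' VS_{m*}(L)` and `VS_{m*}(L) = valueSetMod σ ϖ m* X₊ ↔ ¬ VS_{m*}(L′) = valueSetMod σ ϖ m* X₊`.
WHAT REMAINS for `hL_mix` at `b + 1 ≤ d` (not here): the EXISTENCE of a glued vertex over every member of the cell (★ Lit `UnitaryLatticeTreeBlockGlueFibreCount` §3 + ★ T1
`#Sol_{2b} = q^b`), then ★ HEAD-lo-ω + ★ p863399's fold + ★ `levelSetDep_eq_levelSet_of_add_le`.
HONEST LABEL.  Count-neutral composition; nothing printed is asserted; no census law is stated; `hL_mix` stays OPEN; `HC_CM` is proved only modulo the 7 printed citations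
(2 remaining named inputs: hLiu418 = `stmt-HodgeConjecture-24832`, h413 = `stmt-HodgeConjecture-24833`) until rung 0 closes.
## References
* [Rogawski1990] J. D. Rogawski, *Automorphic Representations of Unitary Groups in Three Variables*, Ann. of Math. Stud. 123 (1990): §4.9 Prop. 4.9.1 (b) p. 55.
* [Serre1979] J.-P. Serre, *Local Fields*, GTM 67 (1979): Ch. V §3 Prop. 5, Cor. 3 (norm classes of units: index two); Ch. III §3 Prop. 7.
* [LabesseLanglands1979] J.-P. Labesse, R. P. Langlands, *L-indistinguishability for SL(2)*, Canad. J. Math. 31 (1979): §2 p. 8 (the norm-residue dichotomy).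
* [Jacobowitz1962] R. Jacobowitz, *Hermitian forms over local fields*, Amer. J. Math. 84 (1962): §4 (duals, gluing).
-/

set_option autoImplicit false

noncomputable section

namespace Summit.HodgeConjecture.HodgeConjecture.Cruxes.H413.F0P3cDyRamLowerLineLabelFlip

open scoped Valued WithZero Matrix MatrixGroups
open WithZero
open Literature.NumberTheory.Automorphic Literature.NumberTheory.Automorphic.HermitianLattice Literature.NumberTheory.Automorphic.UnitaryLatticeTree
open Literature.NumberTheory.Automorphic.UnitaryThreeFourFrame (IsRamifiedQuadraticDatum)
open Literature.NumberTheory.Rogawski1990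
open Summit.HodgeConjecture.HodgeConjecture.Cruxes.H413.F0P3cDyRamFourFramePieces
open Summit.HodgeConjecture.HodgeConjecture.Cruxes.H413.F0P3cDyRamToricCensusDefs
open Summit.HodgeConjecture.HodgeConjecture.Cruxes.H413.F0P3cDyRamShellLineModel (isOrd_mul)
open Summit.HodgeConjecture.HodgeConjecture.Cruxes.H413.F0P3cDyRamLabelShellFlipCardTwo (v_refSkew_eq valueSetMod_smul_xPlus_eq_of_v_sub_le_pred)
open Summit.HodgeConjecture.HodgeConjecture.Cruxes.H413.F0P3cDyRamConeCellFaceAxis (image_mul_valueSetMod_smul_xPlus image_mul_eq_valueSetMod_plus_iff_not inv_fixed_unit_not_norm)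
open Summit.HodgeConjecture.HodgeConjecture.Cruxes.H413.F0P3cDyRamConeWeightHalfSplit (dualGen_mul_left isOrd_mul_left_iff_of_fixed_unit)
open Summit.HodgeConjecture.HodgeConjecture.Cruxes.H413.F0P3cDyRamLowerLineVertexRay (exists_fixed_unit_valueSet_eq_smul_xPlus_of_line_sizes)

variable {E M : Type} [Field E] [Valued E ℤᵐ⁰] [Field M] [Valued M ℤᵐ⁰] {ρ Θ : M →+* M} {α : M}

/-! ## §1 The scalar lemma: two nearly-fixed rays whose scalars differ by a fixed non-norm unit carry opposite labels -/

omit [Field M] [Valued M ℤᵐ⁰] in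
/-- **TWO RAYS WHOSE SCALARS DIFFER BY A FIXED NON-NORM UNIT.**  Sheet datum on `E` (`[CompleteSpace E] [Finite 𝓀[E]]`), `ξ₀` a `σ`-fixed non-norm unit, `e′` a `σ`-fixed unit, `e′₁` any scalar,
with `|e₀ − e′·t₊| ≤ |ϖ|^{m*}` and `|e₀·ξ₀⁻¹ − e′₁·t₊| ≤ |ϖ|^{m*}` (`t₊` the reference skew scalar), `S = valueSetMod σ ϖ m* (e′ • X₊)`, `S′ = valueSetMod σ ϖ m* (e′₁ • X₊)`.  THEN
`S′ = (ξ₀⁻¹·) '' S` and `S = valueSetMod σ ϖ m* X₊ ↔ ¬ S′ = valueSetMod σ ϖ m* X₊`. [cite: Serre1979, Ch. V §3 Cor. 3] [cite: LabesseLanglands1979, §2 p. 8] [cite: Rogawski1990, §4.9 Prop. 4.9.1 (b) p. 55] -/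
theorem flip_ray_letters [CompleteSpace E] [Finite 𝓀[E]] {σ : E →+* E} {ϖ : E} {d t : ℕ} (hD : IsRamifiedQuadraticDatum σ ϖ d t)
    {ξ₀ : E} (hσξ : σ ξ₀ = ξ₀) (hξ1 : Valued.v ξ₀ = 1) (hξN : ¬ ∃ z : E, z * σ z = ξ₀)
    {e₀ e' e'₁ : E} (hσe' : σ e' = e') (he'1 : Valued.v e' = 1)
    (hclose : Valued.v (e₀ - e' * ((ϖ - σ ϖ) * ((ϖ * σ ϖ) ^ ((d - d % 2) / 2))⁻¹)) ≤ Valued.v ϖ ^ mstarOfRecord d)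
    (hclose₁ : Valued.v (e₀ * ξ₀⁻¹ - e'₁ * ((ϖ - σ ϖ) * ((ϖ * σ ϖ) ^ ((d - d % 2) / 2))⁻¹)) ≤ Valued.v ϖ ^ mstarOfRecord d)
    {S S' : Set E} (hS : S = valueSetMod σ ϖ (mstarOfRecord d) (e' • xPlus σ ϖ d)) (hS' : S' = valueSetMod σ ϖ (mstarOfRecord d) (e'₁ • xPlus σ ϖ d)) :
    S' = (fun z => ξ₀⁻¹ * z) '' S ∧
      (S = valueSetMod σ ϖ (mstarOfRecord d) (xPlus σ ϖ d) ↔ ¬ S' = valueSetMod σ ϖ (mstarOfRecord d) (xPlus σ ϖ d)) := by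
  obtain ⟨-, hvσ, hϖ, -, hd, hd1, -⟩ := id hD
  have hm : mstarOfRecord d = d % 2 + 2 * d - 1 := rfl
  have hvϖ0 : Valued.v ϖ ≠ 0 := by rw [hϖ]; exact exp_ne_zero
  obtain ⟨hσξi, hξi1, hξiN⟩ := inv_fixed_unit_not_norm hσξ hξ1 hξN
  have hξ0 : ξ₀ ≠ 0 := fun h0 => by rw [h0, map_zero] at hξ1; exact zero_ne_one hξ1
  -- `|ξ₀⁻¹e′ − e′₁| ≤ |ϖ|^{2d−1}`
  have hvt : Valued.v ((ϖ - σ ϖ) * ((ϖ * σ ϖ) ^ ((d - d % 2) / 2))⁻¹) = Valued.v ϖ ^ (d % 2) := v_refSkew_eq hvσ hϖ hd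
  set tp : E := (ϖ - σ ϖ) * ((ϖ * σ ϖ) ^ ((d - d % 2) / 2))⁻¹ with htp
  have htp0 : tp ≠ 0 := fun h0 => by rw [h0, map_zero] at hvt; exact pow_ne_zero _ hvϖ0 hvt.symm
  have hge : Valued.v (ξ₀⁻¹ * e' - e'₁) ≤ Valued.v ϖ ^ (2 * d - 1) := by
    have e : ξ₀⁻¹ * e' - e'₁ = tp⁻¹ * (ξ₀⁻¹ * (e' * tp - e₀) + (e₀ * ξ₀⁻¹ - e'₁ * tp)) := by field_simp; ring
    rw [e, Valuation.map_mul, map_inv₀, hvt, inv_mul_le_iff₀ (pow_pos (zero_lt_iff.2 hvϖ0) _), ← pow_add,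
      show d % 2 + (2 * d - 1) = mstarOfRecord d by rw [hm]; omega]
    refine (Valuation.map_add _ _ _).trans (max_le ?_ hclose₁)
    rw [Valuation.map_mul, hξi1, one_mul, Valuation.map_sub_swap]
    exact hclose
  have h2 : valueSetMod σ ϖ (mstarOfRecord d) ((ξ₀⁻¹ * e') • xPlus σ ϖ d) = valueSetMod σ ϖ (mstarOfRecord d) (e'₁ • xPlus σ ϖ d) :=
    valueSetMod_smul_xPlus_eq_of_v_sub_le_pred hvσ hϖ hd (show mstarOfRecord d ≤ (2 * d - 1) + d % 2 from by rw [hm]; omega) hge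
  have htrans : S' = (fun z => ξ₀⁻¹ * z) '' S := by
    rw [hS', hS, image_mul_valueSetMod_smul_xPlus σ ϖ d (mstarOfRecord d) e' hξi1, h2]
  refine ⟨htrans, ?_⟩
  have key := image_mul_eq_valueSetMod_plus_iff_not hD hσξi hξi1 hξiN (S := S) ⟨e', hσe', he'1, hS⟩
  rw [← htrans] at key
  exact ⟨fun hb ha => key.1 ha hb, fun hna => by by_contra hb; exact hna (key.2 hb)⟩

/-! ## §2 HEAD — the ω-flip reverses the label of the glued vertices over a lower-line cell member -/

/-- **HEAD — «THE ω-FLIP REVERSES THE LABEL ON THE LOWER LINE».**  ★ p863761's frame and lower-line letters for the glued vertex `L` over `Λ = x₀·𝒪_cc`, an ω-flip `ε`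
(`ε·Θε = jE ξ₀`, `ξ₀` a `σ`-fixed NON-norm unit of `E`) and the glue letters of a second glued vertex `L′` over `ε·Λ = (εx₀)·𝒪_cc` (same cell: same `b`, same `cc`).  THEN
`VS_{m*}(L′) = (ξ₀⁻¹·) '' VS_{m*}(L)` and `VS_{m*}(L) = valueSetMod σ ϖ m* X₊ ↔ ¬ VS_{m*}(L′) = valueSetMod σ ϖ m* X₊` — the `hface` of ★ `…ConeCellFaceTube`'s HEAD-lo-ω for the
pair `(L, L′)`. [cite: Rogawski1990, §4.9 Prop. 4.9.1 (b) p. 55] [cite: Serre1979, Ch. V §3 Cor. 3] [cite: LabesseLanglands1979, §2 p. 8] [cite: Jacobowitz1962, §4] -/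
theorem valueSet_flip_of_line_sizes [CompleteSpace E] [Finite 𝓀[E]] {σ : E →+* E} {ϖ : E} {d t : ℕ} (hD : IsRamifiedQuadraticDatum σ ϖ d t)
    (H₂ : Matrix (Fin 2) (Fin 2) E) (h : E)
    (jE : E →+* M) (hjv : ∀ c, Valued.v (jE c) ≤ 1 ↔ Valued.v c ≤ 1) (hjiso : ∀ c, Valued.v (jE c) = Valued.v c) (hjfix : ∀ z, ρ z = z ↔ ∃ c, jE c = z)
    (hρρ : ∀ x, ρ (ρ x) = x) (hvρ : ∀ x, Valued.v (ρ x) = Valued.v x) (hα : ρ α ≠ α) (hα1 : Valued.v α ≤ 1)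
    (hΘΘ : ∀ x, Θ (Θ x) = x) (hΘρ : ∀ x, Θ (ρ x) = ρ (Θ x)) (hvΘ : ∀ x, Valued.v (Θ x) = Valued.v x) (hΘj : ∀ c, Θ (jE c) = jE (σ c))
    (φ : (Fin 2 → E) →+ M) (hφs : ∀ (c : E) (x : Fin 2 → E), φ (c • x) = jE c * φ x)
    {γ₂ : GL (Fin 2) E} {lam hM : M} (hφγ : ∀ x, φ ((γ₂ : Matrix (Fin 2) (Fin 2) E) *ᵥ x) = lam * φ x) (hhM : hM ≠ 0) (hΘh : Θ hM = hM)
    (hform : ∀ x y, jE (pairing σ H₂ x y) = hM * Θ (φ x) * φ y + ρ (hM * Θ (φ x) * φ y))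
    {L : Submodule 𝒪[E] (Fin 3 → E)} {b : ℕ} (hpr : ∀ x ∈ L, Valued.v (x 1) * Valued.v ϖ ^ b ≤ 1)
    (hint : ∀ y ∈ L, Valued.v (pairing σ (!![H₂ 0 0, 0, H₂ 0 1; 0, h, 0; H₂ 1 0, 0, H₂ 1 1] : Matrix (Fin 3) (Fin 3) E) y y) ≤ 1)
    {B₂ : Submodule 𝒪[E] (Fin 2 → E)} {w₀ : Fin 2 → E} {g₀ : Fin 3 → E}
    (hB : B₂.map ((Matrix.toLin' (!![1, 0; 0, 0; 0, 1] : Matrix (Fin 3) (Fin 2) E)).restrictScalars 𝒪[E]) =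
      L ⊓ LinearMap.ker ((LinearMap.proj (1 : Fin 3) : (Fin 3 → E) →ₗ[E] E).restrictScalars 𝒪[E]))
    (hg₀ : g₀ ∈ L) (hg₀1 : Valued.v (g₀ 1) * Valued.v ϖ ^ b = 1) (hprg : g₀ - Pi.single 1 (g₀ 1) = ![w₀ 0, 0, w₀ 1])
    (u : GL (Fin 1) E)
    {cc x₀ : M} (hc : ρ cc = cc) (hc0 : cc ≠ 0) (hc1 : Valued.v cc ≤ 1) (hcc : cc * (α - ρ α) ≠ 0) (hx₀ : x₀ ≠ 0)
    {Λ : AddSubgroup M} (hBΛ : B₂.toAddSubgroup.map φ = Λ)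
    (hΛx : ∀ x, x ∈ Λ ↔ ∃ ζ, IsOrd ρ α cc ζ ∧ x = x₀ * ζ) (hw₀Y : φ w₀ = (dualGen ρ Θ α cc hM x₀)⁻¹ * x₀)
    (hYO : IsOrd ρ α cc (dualGen ρ Θ α cc hM x₀))
    -- the ω-flip and the SECOND glued vertex `L′` over `ε·Λ = (εx₀)·𝒪_cc`
    {ε : M} {ξ₀ : E} (hε : ε * Θ ε = jE ξ₀) (hσξ : σ ξ₀ = ξ₀) (hξ1 : Valued.v ξ₀ = 1) (hξN : ¬ ∃ z : E, z * σ z = ξ₀)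
    {L' : Submodule 𝒪[E] (Fin 3 → E)} (hpr' : ∀ x ∈ L', Valued.v (x 1) * Valued.v ϖ ^ b ≤ 1)
    (hint' : ∀ y ∈ L', Valued.v (pairing σ (!![H₂ 0 0, 0, H₂ 0 1; 0, h, 0; H₂ 1 0, 0, H₂ 1 1] : Matrix (Fin 3) (Fin 3) E) y y) ≤ 1)
    {B₂' : Submodule 𝒪[E] (Fin 2 → E)} {w₀' : Fin 2 → E} {g₀' : Fin 3 → E}
    (hB' : B₂'.map ((Matrix.toLin' (!![1, 0; 0, 0; 0, 1] : Matrix (Fin 3) (Fin 2) E)).restrictScalars 𝒪[E]) =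
      L' ⊓ LinearMap.ker ((LinearMap.proj (1 : Fin 3) : (Fin 3 → E) →ₗ[E] E).restrictScalars 𝒪[E]))
    (hg₀' : g₀' ∈ L') (hg₀1' : Valued.v (g₀' 1) * Valued.v ϖ ^ b = 1) (hprg' : g₀' - Pi.single 1 (g₀' 1) = ![w₀' 0, 0, w₀' 1])
    {Λ' : AddSubgroup M} (hBΛ' : B₂'.toAddSubgroup.map φ = Λ')
    (hΛx' : ∀ x, x ∈ Λ' ↔ ∃ ζ, IsOrd ρ α cc ζ ∧ x = ε * x₀ * ζ) (hw₀Y' : φ w₀' = (dualGen ρ Θ α cc hM (ε * x₀))⁻¹ * (ε * x₀))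
    -- the LOWER-LINE letters (cell currency)
    (hYb : Valued.v (dualGen ρ Θ α cc hM x₀) = Valued.v (jE ϖ) ^ b) (hcb : Valued.v cc < Valued.v (jE ϖ) ^ b)
    (hμle : Valued.v (lam - jE ((u : Matrix (Fin 1) (Fin 1) E) 0 0)) ≤ Valued.v (jE ϖ) ^ (2 * b + d % 2 + 1))
    (hanti : Valued.v ((lam - jE ((u : Matrix (Fin 1) (Fin 1) E) 0 0)) - ρ (lam - jE ((u : Matrix (Fin 1) (Fin 1) E) 0 0))) =
      Valued.v (cc * (α - ρ α)) * Valued.v (jE ϖ) ^ (b + d % 2))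
    -- the ray-by-trace sizes at `m*` and the skew size at `n`
    (g1 : Valued.v (lam - jE ((u : Matrix (Fin 1) (Fin 1) E) 0 0)) * Valued.v (jE ϖ) ^ (d - 1) ≤
      Valued.v (α - ρ α) * Valued.v (jE ϖ) ^ b * Valued.v (jE ϖ) ^ mstarOfRecord d)
    (g2 : Valued.v (lam - jE ((u : Matrix (Fin 1) (Fin 1) E) 0 0)) * Valued.v (Θ α - α) ≤
      Valued.v (α - ρ α) * Valued.v (jE ϖ) ^ b * Valued.v (jE ϖ) ^ mstarOfRecord d)
    (g3 : Valued.v (lam - jE ((u : Matrix (Fin 1) (Fin 1) E) 0 0)) * Valued.v cc ≤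
      Valued.v (α - ρ α) * Valued.v (jE ϖ) ^ b * Valued.v (jE ϖ) ^ mstarOfRecord d)
    {n : ℕ} (hn : 3 * d - 2 + d % 2 ≤ n)
    (gsk : Valued.v (lam - jE ((u : Matrix (Fin 1) (Fin 1) E) 0 0)) * Valued.v ((lam - jE ((u : Matrix (Fin 1) (Fin 1) E) 0 0)) - ρ (lam - jE ((u : Matrix (Fin 1) (Fin 1) E) 0 0))) ≤
      Valued.v (jE ϖ) ^ n * Valued.v (cc * (α - ρ α)) * Valued.v (jE ϖ) ^ b)
    -- the line-model structure, the ray scalar, the deep tokens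
    (hΘlam : Θ lam * lam = 1) (hvlam : Valued.v lam = 1)
    (huu : ((u : Matrix (Fin 1) (Fin 1) E) 0 0) * σ ((u : Matrix (Fin 1) (Fin 1) E) 0 0) = 1)
    {e₀ : E} (he₀ : jE e₀ = (lam - jE ((u : Matrix (Fin 1) (Fin 1) E) 0 0)) / (cc * (α - ρ α) * Θ (dualGen ρ Θ α cc hM x₀)) +
      ρ ((lam - jE ((u : Matrix (Fin 1) (Fin 1) E) 0 0)) / (cc * (α - ρ α) * Θ (dualGen ρ Θ α cc hM x₀))))
    (hlamn : Valued.v (lam - 1) ≤ Valued.v (jE ϖ) ^ n) (hun : Valued.v ((u : Matrix (Fin 1) (Fin 1) E) 0 0 - 1) ≤ Valued.v ϖ ^ n) :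
    {z : E | ∃ y ∈ L', Valued.v ((ϖ ^ mstarOfRecord d)⁻¹ * (z - pairing σ (!![H₂ 0 0, 0, H₂ 0 1; 0, h, 0; H₂ 1 0, 0, H₂ 1 1] : Matrix (Fin 3) (Fin 3) E) y
          ((((endoGL (γ₂, u) : GL (Fin 3) E) : Matrix (Fin 3) (Fin 3) E) - 1) *ᵥ y))) ≤ 1} =
      (fun z => ξ₀⁻¹ * z) ''
        {z : E | ∃ y ∈ L, Valued.v ((ϖ ^ mstarOfRecord d)⁻¹ * (z - pairing σ (!![H₂ 0 0, 0, H₂ 0 1; 0, h, 0; H₂ 1 0, 0, H₂ 1 1] : Matrix (Fin 3) (Fin 3) E) y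
          ((((endoGL (γ₂, u) : GL (Fin 3) E) : Matrix (Fin 3) (Fin 3) E) - 1) *ᵥ y))) ≤ 1} ∧
      ({z : E | ∃ y ∈ L, Valued.v ((ϖ ^ mstarOfRecord d)⁻¹ * (z - pairing σ (!![H₂ 0 0, 0, H₂ 0 1; 0, h, 0; H₂ 1 0, 0, H₂ 1 1] : Matrix (Fin 3) (Fin 3) E) y
          ((((endoGL (γ₂, u) : GL (Fin 3) E) : Matrix (Fin 3) (Fin 3) E) - 1) *ᵥ y))) ≤ 1} = valueSetMod σ ϖ (mstarOfRecord d) (xPlus σ ϖ d) ↔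
        ¬ {z : E | ∃ y ∈ L', Valued.v ((ϖ ^ mstarOfRecord d)⁻¹ * (z - pairing σ (!![H₂ 0 0, 0, H₂ 0 1; 0, h, 0; H₂ 1 0, 0, H₂ 1 1] : Matrix (Fin 3) (Fin 3) E) y
          ((((endoGL (γ₂, u) : GL (Fin 3) E) : Matrix (Fin 3) (Fin 3) E) - 1) *ᵥ y))) ≤ 1} = valueSetMod σ ϖ (mstarOfRecord d) (xPlus σ ϖ d)) := by
  obtain ⟨-, hvσ, hϖ, -, -, -, -⟩ := id hD
  have hvϖ0 : Valued.v ϖ ≠ 0 := by rw [hϖ]; exact exp_ne_zero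
  have hϖ0 : ϖ ≠ 0 := fun h0 => hvϖ0 (by rw [h0, map_zero])
  have hjϖ0 : jE ϖ ≠ 0 := (map_ne_zero jE).2 hϖ0
  have hρξ : ρ (jE ξ₀) = jE ξ₀ := (hjfix _).2 ⟨ξ₀, rfl⟩
  have hjξ1 : Valued.v (jE ξ₀) = 1 := by rw [hjiso, hξ1]
  have hjξ0 : jE ξ₀ ≠ 0 := fun h0 => by rw [h0, map_zero] at hjξ1; exact zero_ne_one hjξ1
  have hξ0 : ξ₀ ≠ 0 := fun h0 => hjξ0 (by rw [h0, map_zero])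
  have hε0 : ε ≠ 0 := fun h0 => hjξ0 (by rw [← hε, h0, zero_mul])
  have hx₀' : ε * x₀ ≠ 0 := mul_ne_zero hε0 hx₀
  -- the dual generator and the ray scalar of the flipped vertex
  have hY' : dualGen ρ Θ α cc hM (ε * x₀) = jE ξ₀ * dualGen ρ Θ α cc hM x₀ := dualGen_mul_left hε cc hM x₀
  have hYO' : IsOrd ρ α cc (dualGen ρ Θ α cc hM (ε * x₀)) := by
    rw [hY']; exact (isOrd_mul_left_iff_of_fixed_unit hρξ hjξ1 cc _).2 hYO
  have hYb' : Valued.v (dualGen ρ Θ α cc hM (ε * x₀)) = Valued.v (jE ϖ) ^ b := by rw [hY', Valuation.map_mul, hjξ1, one_mul, hYb]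
  have he₀' : jE (e₀ * ξ₀⁻¹) = (lam - jE ((u : Matrix (Fin 1) (Fin 1) E) 0 0)) / (cc * (α - ρ α) * Θ (dualGen ρ Θ α cc hM (ε * x₀))) +
      ρ ((lam - jE ((u : Matrix (Fin 1) (Fin 1) E) 0 0)) / (cc * (α - ρ α) * Θ (dualGen ρ Θ α cc hM (ε * x₀)))) := by
    have hΘξ : Θ (jE ξ₀) = jE ξ₀ := by rw [hΘj, hσξ]
    have e1 : (lam - jE ((u : Matrix (Fin 1) (Fin 1) E) 0 0)) / (cc * (α - ρ α) * Θ (dualGen ρ Θ α cc hM (ε * x₀))) =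
        (lam - jE ((u : Matrix (Fin 1) (Fin 1) E) 0 0)) / (cc * (α - ρ α) * Θ (dualGen ρ Θ α cc hM x₀)) * (jE ξ₀)⁻¹ := by
      rw [hY', map_mul, hΘξ]
      field_simp
    rw [e1, map_mul ρ, map_inv₀ ρ, hρξ, ← add_mul, ← he₀, map_mul, map_inv₀]
  -- the two rays (★ p863761 twice)
  obtain ⟨e', hσe', he'1, hclose, hS⟩ := exists_fixed_unit_valueSet_eq_smul_xPlus_of_line_sizes hD H₂ h jE hjv hjiso hjfix hρρ hvρ hα hα1 hΘΘ hΘρ hvΘ hΘj φ hφs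
    hφγ hhM hΘh hform hpr hint hB hg₀ hg₀1 hprg u hc hc0 hc1 hcc hx₀ hBΛ hΛx hw₀Y hYO hYb hcb hμle hanti g1 g2 g3 hn gsk hΘlam hvlam huu he₀ hlamn hun
  obtain ⟨e'₁, -, -, hclose₁, hS'⟩ := exists_fixed_unit_valueSet_eq_smul_xPlus_of_line_sizes hD H₂ h jE hjv hjiso hjfix hρρ hvρ hα hα1 hΘΘ hΘρ hvΘ hΘj φ hφs
    hφγ hhM hΘh hform hpr' hint' hB' hg₀' hg₀1' hprg' u hc hc0 hc1 hcc hx₀' hBΛ' hΛx' hw₀Y' hYO' hYb' hcb hμle hanti g1 g2 g3 hn gsk hΘlam hvlam huu he₀' hlamn hun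
  exact flip_ray_letters hD hσξ hξ1 hξN hσe' he'1 hclose hclose₁ hS hS'

end Summit.HodgeConjecture.HodgeConjecture.Cruxes.H413.F0P3cDyRamLowerLineLabelFlip

end
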